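import Mathlib
import Literature.MathematicalPhysics.QuantumLattice.HubbardEffectiveActionCT

/-!
# Crux `SeededBrokenRegimeBoseFermiPinned` (stmt-HubbardSuperconductivity-14047), line `seed-strength-flow` — stub `stub_seedSliceBound` (S1)

WHAT. The first lemma of the line: the Koma–Tasaki pair seed `h` is a regular GAUSSIAN parameter of
the countertermed free covariance above a fermionic scale. Concretely, for the seeded Nambu
propagator in a counterterm frame `K` (`nambuPropagatorCT`,
`Literature/MathematicalPhysics/QuantumLattice/HubbardEffectiveActionCT.lean`), with
`ω = matsubaraFreq β M k.1`, `e = nambuXiCT L μ K k.2`, `φ = dWaveSymbol L k.2`,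
`D_h = ω² + e² + (hφ)²` (`nambuDenCT`) and entries
`[[iω + e, hφ], [hφ, iω − e]] / D_h`, every entry is differentiable in the seed strength `h` and,
whenever `ω² + e² ≥ Λ² > 0`, `‖∂_h G_ab‖ ≤ |φ| / Λ²`.

SOURCE: folklore one-variable calculus. Writing `D := ω² + e² ≥ Λ²`, `x := h²φ²`:
* off-diagonal: `∂_h (hφ/(D + h²φ²)) = φ(D − h²φ²)/(D + h²φ²)²`, of modulus
  `≤ |φ|(D + x)/(D + x)² = |φ|/(D + x) ≤ |φ|/Λ²`;
* diagonal: `∂_h ((iω ± e)/(D + h²φ²)) = −(iω ± e)·2hφ²/(D + h²φ²)²`, of norm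
  `√D · 2|h|φ²/(D + x)²`, and `2 a³ b ≤ (a² + b²)²` (`a = √D`, `b = |hφ|`; indeed
  `(a² + b²)² − 2a³b = a²(a − b)² + a²b² + b⁴`) gives `≤ |φ|/a² ≤ |φ|/Λ²`.
Differentiability: the denominator `D + h'²φ² ≥ Λ² > 0` never vanishes.

The file proves the two entry shapes generically (`seedSlice_constDiv`, `seedSlice_offDiag`) and
assembles `stub_seedSliceBound` by `fin_cases` on the matrix indices (the entries of
`nambuPropagatorCT` unfold definitionally to the two shapes).
-/

set_option linter.dupNamespace false -- Summit.<S>.<S> doubles the summit name (tree convention)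

namespace Summit.HubbardSuperconductivity.HubbardSuperconductivity.Theorems.AposterioriCapRgSeededBrokenRegimeBoseFermiPinned

open Literature.MathematicalPhysics.QuantumLattice Literature.Probability.LatticeModels GrassmannAlgebra

/-! ### Derivatives of the two entry shapes -/

/-- `∂_{h'} (D + (h'φ)²) = 2hφ²` at `h' = h`, as a map `ℝ → ℂ`. [folklore] -/
theorem seedDen_hasDerivAt (D φ h : ℝ) :
    HasDerivAt (fun h' : ℝ => ((D + (h' * φ) ^ 2 : ℝ) : ℂ)) ((2 * h * φ ^ 2 : ℝ) : ℂ) h := by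
  have h1 : HasDerivAt (fun h' : ℝ => D + (h' * φ) ^ 2) (2 * h * φ ^ 2) h := by
    refine (((hasDerivAt_mul_const φ).fun_pow 2).const_add D).congr_deriv ?_
    rw [show (2 : ℕ) - 1 = 1 from rfl, pow_one]
    push_cast
    ring
  exact h1.ofReal_comp

/-- The denominator `D + (hφ)²` is positive once `D ≥ Λ² > 0`. [folklore] -/
theorem seedDen_pos {D Λ : ℝ} (h φ : ℝ) (hΛ : 0 < Λ) (hΛD : Λ ^ 2 ≤ D) : 0 < D + (h * φ) ^ 2 := by
  have hD : 0 < D := lt_of_lt_of_le (pow_pos hΛ 2) hΛD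
  positivity

/-- Diagonal shape: `∂_{h'} (c/(D + (h'φ)²)) = −c·2hφ²/(D + (hφ)²)²` at `h' = h`. [folklore] -/
theorem seedConstDiv_hasDerivAt (c : ℂ) (D φ h : ℝ) (hD : D + (h * φ) ^ 2 ≠ 0) :
    HasDerivAt (fun h' : ℝ => c / ((D + (h' * φ) ^ 2 : ℝ) : ℂ))
      (-(c * ((2 * h * φ ^ 2 : ℝ) : ℂ)) / ((D + (h * φ) ^ 2 : ℝ) : ℂ) ^ 2) h := by
  have hD' : ((D + (h * φ) ^ 2 : ℝ) : ℂ) ≠ 0 := by exact_mod_cast hD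
  refine ((hasDerivAt_const h c).div (seedDen_hasDerivAt D φ h) hD').congr_deriv ?_
  ring

/-- Off-diagonal shape: `∂_{h'} (h'φ/(D + (h'φ)²)) = φ(D − (hφ)²)/(D + (hφ)²)²` at `h' = h`. [folklore] -/
theorem seedOffDiag_hasDerivAt (D φ h : ℝ) (hD : D + (h * φ) ^ 2 ≠ 0) :
    HasDerivAt (fun h' : ℝ => ((h' * φ : ℝ) : ℂ) / ((D + (h' * φ) ^ 2 : ℝ) : ℂ))
      ((φ * (D - (h * φ) ^ 2) / (D + (h * φ) ^ 2) ^ 2 : ℝ) : ℂ) h := by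
  have hD' : ((D + (h * φ) ^ 2 : ℝ) : ℂ) ≠ 0 := by exact_mod_cast hD
  have hnum : HasDerivAt (fun h' : ℝ => ((h' * φ : ℝ) : ℂ)) ((φ : ℝ) : ℂ) h :=
    (hasDerivAt_mul_const φ).ofReal_comp
  refine (hnum.div (seedDen_hasDerivAt D φ h) hD').congr_deriv ?_
  push_cast
  field_simp
  ring

/-! ### The two real inequalities -/

/-- `2a³b ≤ (a² + b²)²` for `a, b ≥ 0`: `(a² + b²)² − 2a³b = a²(a − b)² + a²b² + b⁴`. [folklore] -/
theorem two_mul_cube_mul_le_sq (a b : ℝ) : 2 * a ^ 3 * b ≤ (a ^ 2 + b ^ 2) ^ 2 := by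
  nlinarith [mul_nonneg (sq_nonneg a) (sq_nonneg (a - b)), sq_nonneg (a * b), sq_nonneg (b ^ 2)]

/-- Diagonal bound: `a · |2hφ²| / (a² + (hφ)²)² ≤ |φ|/Λ²` for `0 ≤ a`, `Λ² ≤ a²`, `0 < Λ`. [folklore] -/
theorem seedDiag_real_bound (a Λ h φ : ℝ) (ha : 0 ≤ a) (hΛ : 0 < Λ) (hΛa : Λ ^ 2 ≤ a ^ 2) :
    a * |2 * h * φ ^ 2| / (a ^ 2 + (h * φ) ^ 2) ^ 2 ≤ |φ| / Λ ^ 2 := by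
  have hden : 0 < a ^ 2 + (h * φ) ^ 2 := seedDen_pos h φ hΛ hΛa
  set b := |h * φ| with hb_def
  have hb : 0 ≤ b := abs_nonneg _
  have hnum : |2 * h * φ ^ 2| = 2 * b * |φ| := by
    rw [hb_def, show 2 * h * φ ^ 2 = 2 * ((h * φ) * φ) by ring, abs_mul, abs_mul, abs_two]
    ring
  have hsq : (h * φ) ^ 2 = b ^ 2 := (sq_abs (h * φ)).symm
  rw [hnum, hsq, div_le_div_iff₀ (by rw [← hsq]; positivity) (by positivity)]
  have key := two_mul_cube_mul_le_sq a b
  have h1 : a * (2 * b * |φ|) * Λ ^ 2 ≤ a * (2 * b * |φ|) * a ^ 2 :=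
    mul_le_mul_of_nonneg_left hΛa (by positivity)
  have h2 : a * (2 * b * |φ|) * a ^ 2 = (2 * a ^ 3 * b) * |φ| := by ring
  have h3 : (2 * a ^ 3 * b) * |φ| ≤ (a ^ 2 + b ^ 2) ^ 2 * |φ| :=
    mul_le_mul_of_nonneg_right key (abs_nonneg φ)
  linarith

/-- Off-diagonal bound: `|φ(D − (hφ)²)/(D + (hφ)²)²| ≤ |φ|/Λ²` for `Λ² ≤ D`, `0 < Λ`. [folklore] -/
theorem seedOffDiag_real_bound (D Λ h φ : ℝ) (hΛ : 0 < Λ) (hΛD : Λ ^ 2 ≤ D) :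
    |φ * (D - (h * φ) ^ 2) / (D + (h * φ) ^ 2) ^ 2| ≤ |φ| / Λ ^ 2 := by
  have hden : 0 < D + (h * φ) ^ 2 := seedDen_pos h φ hΛ hΛD
  have hD : 0 ≤ D := le_trans (sq_nonneg Λ) hΛD
  have hsub : |D - (h * φ) ^ 2| ≤ D + (h * φ) ^ 2 :=
    abs_sub_le_iff.2 ⟨by nlinarith [sq_nonneg (h * φ)], by nlinarith [sq_nonneg (h * φ)]⟩
  rw [abs_div, abs_mul, abs_of_pos (pow_pos hden 2)]
  calc |φ| * |D - (h * φ) ^ 2| / (D + (h * φ) ^ 2) ^ 2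
      ≤ |φ| * (D + (h * φ) ^ 2) / (D + (h * φ) ^ 2) ^ 2 := by gcongr
    _ = |φ| / (D + (h * φ) ^ 2) := by
        rw [pow_two (D + (h * φ) ^ 2), mul_div_mul_right _ _ hden.ne']
    _ ≤ |φ| / Λ ^ 2 :=
        div_le_div_of_nonneg_left (abs_nonneg φ) (pow_pos hΛ 2) (by nlinarith [sq_nonneg (h * φ)])

/-! ### The two entry shapes: differentiability and derivative bound -/

/-- `‖iω + e‖² = ω² + e²`. [folklore] -/
theorem norm_sq_I_mul_add (ω e : ℝ) : ‖Complex.I * ω + e‖ ^ 2 = ω ^ 2 + e ^ 2 := by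
  rw [Complex.sq_norm, show Complex.I * ω + e = (e : ℂ) + ω * Complex.I by ring,
    Complex.normSq_add_mul_I]
  ring

/-- `‖iω − e‖² = ω² + e²`. [folklore] -/
theorem norm_sq_I_mul_sub (ω e : ℝ) : ‖Complex.I * ω - e‖ ^ 2 = ω ^ 2 + e ^ 2 := by
  rw [Complex.sq_norm, show Complex.I * ω - e = ((-e : ℝ) : ℂ) + ω * Complex.I by push_cast; ring,
    Complex.normSq_add_mul_I]
  ring

/-- Diagonal entries: `h' ↦ c/(D + (h'φ)²)` with `‖c‖² = D ≥ Λ² > 0` is differentiable with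
`‖∂_h‖ ≤ |φ|/Λ²`. [folklore] -/
theorem seedSlice_constDiv (c : ℂ) (D Λ h φ : ℝ) (hc : ‖c‖ ^ 2 = D) (hΛ : 0 < Λ) (hΛD : Λ ^ 2 ≤ D) :
    DifferentiableAt ℝ (fun h' : ℝ => c / ((D + (h' * φ) ^ 2 : ℝ) : ℂ)) h ∧
      ‖deriv (fun h' : ℝ => c / ((D + (h' * φ) ^ 2 : ℝ) : ℂ)) h‖ ≤ |φ| / Λ ^ 2 := by
  have hden : 0 < D + (h * φ) ^ 2 := seedDen_pos h φ hΛ hΛD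
  have hd := seedConstDiv_hasDerivAt c D φ h hden.ne'
  refine ⟨hd.differentiableAt, ?_⟩
  rw [hd.deriv, norm_div, norm_neg, norm_mul, norm_pow, Complex.norm_real, Complex.norm_real,
    Real.norm_eq_abs, Real.norm_eq_abs, abs_of_pos hden]
  subst hc
  exact seedDiag_real_bound ‖c‖ Λ h φ (norm_nonneg c) hΛ hΛD

/-- Off-diagonal entries: `h' ↦ h'φ/(D + (h'φ)²)` with `D ≥ Λ² > 0` is differentiable with
`‖∂_h‖ ≤ |φ|/Λ²`. [folklore] -/
theorem seedSlice_offDiag (D Λ h φ : ℝ) (hΛ : 0 < Λ) (hΛD : Λ ^ 2 ≤ D) :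
    DifferentiableAt ℝ (fun h' : ℝ => ((h' * φ : ℝ) : ℂ) / ((D + (h' * φ) ^ 2 : ℝ) : ℂ)) h ∧
      ‖deriv (fun h' : ℝ => ((h' * φ : ℝ) : ℂ) / ((D + (h' * φ) ^ 2 : ℝ) : ℂ)) h‖ ≤ |φ| / Λ ^ 2 := by
  have hden : 0 < D + (h * φ) ^ 2 := seedDen_pos h φ hΛ hΛD
  have hd := seedOffDiag_hasDerivAt D φ h hden.ne'
  refine ⟨hd.differentiableAt, ?_⟩
  rw [hd.deriv, Complex.norm_real, Real.norm_eq_abs]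
  exact seedOffDiag_real_bound D Λ h φ hΛ hΛD

/-! ### S1 -/

/-- **S1 (`SeedSliceBound`)**: above a fermionic scale `Λ` (`ω² + e_K² ≥ Λ²`) every entry of the
seeded Nambu propagator in the frame `K` is differentiable in the seed strength, with
`‖∂_h G_ab‖ ≤ |φ_d|/Λ²`. [folklore] -/
theorem stub_seedSliceBound :
    ∀ (L M : ℕ) [NeZero L] (β μ Λ h : ℝ) (K : TrigPolyC4v) (k : FreqMomentum L M) (i j : Fin 2),
      0 < Λ → Λ ^ 2 ≤ matsubaraFreq β M k.1 ^ 2 + nambuXiCT L μ K k.2 ^ 2 →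
        DifferentiableAt ℝ (fun h' : ℝ => nambuPropagatorCT L M β μ h' K k i j) h ∧
        ‖deriv (fun h' : ℝ => nambuPropagatorCT L M β μ h' K k i j) h‖ ≤ |dWaveSymbol L k.2| / Λ ^ 2 := by
  intro L M _ β μ Λ h K k i j hΛ hΛD
  fin_cases i <;> fin_cases j
  · exact seedSlice_constDiv (Complex.I * matsubaraFreq β M k.1 + nambuXiCT L μ K k.2)
      (matsubaraFreq β M k.1 ^ 2 + nambuXiCT L μ K k.2 ^ 2) Λ h (dWaveSymbol L k.2)
      (norm_sq_I_mul_add _ _) hΛ hΛD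
  · exact seedSlice_offDiag (matsubaraFreq β M k.1 ^ 2 + nambuXiCT L μ K k.2 ^ 2) Λ h
      (dWaveSymbol L k.2) hΛ hΛD
  · exact seedSlice_offDiag (matsubaraFreq β M k.1 ^ 2 + nambuXiCT L μ K k.2 ^ 2) Λ h
      (dWaveSymbol L k.2) hΛ hΛD
  · exact seedSlice_constDiv (Complex.I * matsubaraFreq β M k.1 - nambuXiCT L μ K k.2)
      (matsubaraFreq β M k.1 ^ 2 + nambuXiCT L μ K k.2 ^ 2) Λ h (dWaveSymbol L k.2)
      (norm_sq_I_mul_sub _ _) hΛ hΛD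

end Summit.HubbardSuperconductivity.HubbardSuperconductivity.Theorems.AposterioriCapRgSeededBrokenRegimeBoseFermiPinned
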